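import Mathlib.MeasureTheory.Group.FundamentalDomain
import HarnessLib

/-!
# F0 · P3c · line LH6 «StCharTS» — «HEIGHT-SHELL FUNDAMENTAL DOMAINS★» (generic base layer, Mathlib-only): the shells `{A/q < m ≤ A}` of a height `m` with
# `m(γ • x) = q · m(x)` are fundamental domains for `γ^ℤ`; shell-independence of invariant integrals; an invariant integrand with a commuting
# measure-preserving eigen-symmetry of eigenvalue `≠ 1` integrates to `0` over a fundamental domain [TateThesis1967 §2.3–2.4; WeilBNT1967 II §5 Prop. 12; BourbakiINT7 VII §2 no. 10]

Cell `pub/hodgecm-mathlib`, crux H413 = `stmt-HodgeConjecture-24833` (lane `--supports … --as helper`), route HCCMUnconditional; seat F0P2-p06 (g21); a GENERIC brick under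
LEAD F0P3a-plan (g15) STANDING RULE 20 (T14-67: theorems-only base layer, no road ∕ organ ∕ rider).  THEOREMS ONLY (0 def ∕ 0 instance ∕ 0 notation ∕ 0 sorry); imports
Mathlib + HarnessLib only.  Nothing here is specific to `U(3)`, to local fields or to characters: it is the measure-theoretic skeleton of «integrate shell by shell».

WHAT.  `G` a group acting on a measurable space `α`, `μ` a measure on `α`, `γ ∈ G`, and a HEIGHT `m : α → ℝ` scaled by `γ`: `m (γ • x) = q · m x` with `q > 1` (think: `α = E_w`,
`γ` = multiplication by a non-unit-modulus element, `m = ‖·‖_w`, `q = ‖γ‖⁻¹`; or `α = N(L⁺_v)`, `γ` = a torus conjugation, `m = ‖z(·)‖`).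
* §1 `height_zpow_smul`: `m (γ^k • x) = q^k · m x` (`k ∈ ℤ`); `smul_invariant_zpowers`: a `γ`-invariant function is `γ^ℤ`-invariant.
* §2 **`isFundamentalDomain_heightShell`**: if `m > 0` μ-a.e. and the shell `S_A := m⁻¹(A/q, A]` (`A > 0`) is null-measurable, then `S_A` is a fundamental domain (Mathlib
  `MeasureTheory.IsFundamentalDomain`) for the subgroup `zpowers γ` — every orbit point of positive height visits the shell exactly once (`existsUnique_zpow_mul_mem_Ioc`,
  Mathlib `exists_mem_Ioc_zpow`), and distinct translates of the shell are disjoint (`disjoint_zpow_smul_heightShell`).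
* §3 SHELL INDEPENDENCE (for a `G`-invariant `μ`): **`measure_heightShell_eq`** (`μ S_A = μ S_{A'}`), **`measure_inter_heightShell_eq`** (same for `T ∩ S_A`, `T` invariant),
  **`setLIntegral_heightShell_eq`** ∕ **`setIntegral_heightShell_eq`** (`∫_{S_A} f = ∫_{S_{A'}} f` for `γ`-invariant `f`) — wrappers of Mathlib `IsFundamentalDomain.measure_eq ∕
  measure_set_eq ∕ setLIntegral_eq ∕ setIntegral_eq`; `measure_heightShell_ne_zero` (`μ ≠ 0 ⇒ μ S_A ≠ 0`).
* §4 THE VANISHING ENGINE: **`isFundamentalDomain_smul_of_commute`** (a translate `g₀ • s` of a `zpowers γ`-fundamental domain by an element commuting with `γ` and preserving `μ`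
  is again one), **`setIntegral_smul_eq_setIntegral_comp_smul`** (`∫_{g₀ • s} f = ∫_s f (g₀ • ·)`), and **`setIntegral_eq_zero_of_eigen_smul`**: if `f` is `γ`-invariant and
  `f (g₀ • x) = c • f x` with `c ≠ 1`, then `∫_s f dμ = 0` over EVERY fundamental domain `s` of `zpowers γ` — the abstract form of «a non-trivial character integrates to zero
  over a period annulus» (`∫_{ϖ^k 𝒪^×} χ d×x = 0` for ramified `χ`, two-shell cancellation for `χ(ϖ) = −1`, … with NO case distinction).
* §5 `measurableConstSMul_zpowers`, `smulInvariantMeasure_zpowers`: the two instance hypotheses of §3–§4 on `zpowers γ` from measurability ∕ measure preservation of `γ^{±1}` alone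
  (so `G` may be `Equiv.Perm α`, `Rˣ`, a torus, …; §3–§4 ask the instances on the SUBGROUP only).
CONSUMER-IN-WAITING (rule 20): MEMO `F0/P2/F0P2-p06/g21/MEMO-KEYS3-analytic-road.v3` bricks B2 «INVOLUTION-RING POLAR SLICE» (§3 (i): inner shell mass constant; (ii): the two-shell
character integral vanishes), B3 «HEISENBERG ANNULUS SLICE» (§2: the `x`-shell mass `V` is `A`-independent) of the in-house road to RUNG 0's named input `hKeysRed3` [Keys1984 §7];
reusable by every Tate-shell ∕ lattice-shell bookkeeping in the cell (orbital integrals shell by shell, `∑_k ∫_{ϖ^k𝒪^×}`).  No census row names it yet.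
HONEST LABEL: HC_CM is proved only modulo the 7 printed citations (2 remaining named inputs: hLiu418 = `stmt-HodgeConjecture-24832`, h413 = `stmt-HodgeConjecture-24833`) until rung 0
closes; count-neutral generic measure theory.

## References
* [TateThesis1967] J. Tate, *Fourier analysis in number fields and Hecke's zeta-functions*, in Cassels–Fröhlich, *Algebraic Number Theory* (1967), §2.3–2.4 (shell decomposition
  `k^× = ⊔ ϖ^n 𝒪^×`, `∫_{𝒪^×} χ = 0` for ramified `χ`).
* [WeilBNT1967] A. Weil, *Basic Number Theory*, Grundlehren 144 (1967), Ch. II §5 Prop. 12, Ch. VII §2 (integration over `k^×` by shells of the module).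
* [BourbakiINT7] N. Bourbaki, *Intégration*, Ch. VII §2 no. 10 (quotient measures and fundamental domains of discrete subgroups).
-/

set_option autoImplicit false
-- the mandated namespace has the single-problem summit's repeated segment (`HodgeConjecture.HodgeConjecture`)
set_option linter.dupNamespace false

noncomputable section

open MeasureTheory Set
open scoped Pointwise

namespace Summit.HodgeConjecture.HodgeConjecture.Cruxes.H413.F0P3cStCharTSHeightShellFundamentalDomain

variable {G α : Type*} [Group G] [MulAction G α]

/-! ## §1 Heights along `γ^ℤ` -/

/-- **`m (γ⁻¹ • x) = q⁻¹ · m x`** for a height scaled by `γ`. [cite: WeilBNT1967, Ch. II §5 Prop. 12] -/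
theorem height_inv_smul {m : α → ℝ} {γ : G} {q : ℝ} (hq : q ≠ 0) (hγ : ∀ x, m (γ • x) = q * m x) (x : α) :
    m (γ⁻¹ • x) = q⁻¹ * m x := by
  have h := hγ (γ⁻¹ • x)
  rw [smul_inv_smul] at h
  rw [h, inv_mul_cancel_left₀ hq]

/-- **`m (γ^k • x) = q^k · m x`** for every `k ∈ ℤ`. [cite: WeilBNT1967, Ch. II §5 Prop. 12] -/
theorem height_zpow_smul {m : α → ℝ} {γ : G} {q : ℝ} (hq : q ≠ 0) (hγ : ∀ x, m (γ • x) = q * m x) (k : ℤ) (x : α) :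
    m (γ ^ k • x) = q ^ k * m x := by
  induction k using Int.induction_on generalizing x with
  | zero => simp
  | succ n ih =>
    rw [zpow_add_one, mul_smul, zpow_add_one₀ hq, ih (γ • x), hγ]; ring
  | pred n ih =>
    rw [zpow_sub_one, mul_smul, zpow_sub_one₀ hq, ih (γ⁻¹ • x), height_inv_smul hq hγ]; ring

/-- **A `γ`-invariant function is invariant under the whole subgroup `zpowers γ`.** [cite: TateThesis1967, §2.3] -/
theorem smul_invariant_zpowers {β : Type*} {f : α → β} {γ : G} (hf : ∀ x, f (γ • x) = f x) (g : ↥(Subgroup.zpowers γ)) (x : α) :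
    f (g • x) = f x := by
  obtain ⟨g, k, rfl⟩ := g
  change f (γ ^ k • x) = f x
  induction k using Int.induction_on generalizing x with
  | zero => simp
  | succ n ih => rw [zpow_add_one, mul_smul, ih, hf]
  | pred n ih =>
    have h := hf (γ⁻¹ • x)
    rw [smul_inv_smul] at h
    rw [zpow_sub_one, mul_smul, ih, ← h]

/-- Invariance of a SET under `zpowers γ` from invariance under `γ` (preimage form, as Mathlib `IsFundamentalDomain.measure_set_eq` wants it). [cite: TateThesis1967, §2.3] -/
theorem preimage_smul_eq_of_zpowers {T : Set α} {γ : G} (hT : (fun x => γ • x) ⁻¹' T = T) (g : ↥(Subgroup.zpowers γ)) :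
    (fun x => g • x) ⁻¹' T = T := by
  ext x
  have h := smul_invariant_zpowers (f := fun x => (x ∈ T : Prop)) (γ := γ)
    (fun y => propext (by simpa using Set.ext_iff.1 hT y)) g x
  exact Iff.of_eq h

/-! ## §2 The shells are fundamental domains for `zpowers γ` -/

/-- **Two points of one `q^ℤ`-orbit in the same shell `(A/q, A]` coincide**: `q^k t, q^j t ∈ (A/q, A] ⟹ k = j` (`q > 1`, `t > 0`). [cite: WeilBNT1967, Ch. II §5 Prop. 12] -/
theorem zpow_eq_of_zpow_mul_mem_Ioc {q t A : ℝ} (hq : 1 < q) (ht : 0 < t) {k j : ℤ}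
    (hk : q ^ k * t ∈ Set.Ioc (A / q) A) (hj : q ^ j * t ∈ Set.Ioc (A / q) A) : k = j := by
  have hq0 : 0 < q := lt_trans zero_lt_one hq
  -- `q^k t ≤ A < q · q^j t = q^{j+1} t` and symmetrically
  have h1 : q ^ k * t < q ^ (j + 1) * t := by
    rw [zpow_add_one₀ hq0.ne', mul_right_comm]
    exact lt_of_le_of_lt hk.2 ((div_lt_iff₀ hq0).1 hj.1)
  have h2 : q ^ j * t < q ^ (k + 1) * t := by
    rw [zpow_add_one₀ hq0.ne', mul_right_comm]
    exact lt_of_le_of_lt hj.2 ((div_lt_iff₀ hq0).1 hk.1)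
  have h1' : k < j + 1 := (zpow_lt_zpow_iff_right₀ hq).1 (lt_of_mul_lt_mul_right h1 ht.le)
  have h2' : j < k + 1 := (zpow_lt_zpow_iff_right₀ hq).1 (lt_of_mul_lt_mul_right h2 ht.le)
  omega

/-- **Every positive real visits the shell `(A/q, A]` exactly once along `q^ℤ`** (`q > 1`, `A > 0`): `∃! k, q^k · t ∈ (A/q, A]`. [cite: WeilBNT1967, Ch. II §5 Prop. 12] -/
theorem existsUnique_zpow_mul_mem_Ioc {q t A : ℝ} (hq : 1 < q) (ht : 0 < t) (hA : 0 < A) :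
    ∃! k : ℤ, q ^ k * t ∈ Set.Ioc (A / q) A := by
  have hq0 : 0 < q := lt_trans zero_lt_one hq
  -- existence: `t / A ∈ (q^n, q^(n+1)]` for some `n`; take `k = -(n+1)`
  obtain ⟨n, hn1, hn2⟩ := exists_mem_Ioc_zpow (div_pos ht hA) hq
  have hqn : 0 < q ^ n * q := mul_pos (zpow_pos hq0 n) hq0
  have e1 : q ^ (-(n + 1)) * t = t / (q ^ n * q) := by
    rw [zpow_neg, zpow_add_one₀ hq0.ne', inv_mul_eq_div]
  refine ⟨-(n + 1), ⟨?_, ?_⟩, fun k hk => zpow_eq_of_zpow_mul_mem_Ioc hq ht hk ⟨?_, ?_⟩⟩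
  · rw [e1, lt_div_iff₀ hqn]
    calc A / q * (q ^ n * q) = q ^ n * A := by field_simp
      _ < t := (lt_div_iff₀ hA).1 hn1
  · rw [e1, div_le_iff₀ hqn]
    calc t ≤ q ^ (n + 1) * A := (div_le_iff₀ hA).1 hn2
      _ = A * (q ^ n * q) := by rw [zpow_add_one₀ hq0.ne']; ring
  · rw [e1, lt_div_iff₀ hqn]
    calc A / q * (q ^ n * q) = q ^ n * A := by field_simp
      _ < t := (lt_div_iff₀ hA).1 hn1
  · rw [e1, div_le_iff₀ hqn]
    calc t ≤ q ^ (n + 1) * A := (div_le_iff₀ hA).1 hn2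
      _ = A * (q ^ n * q) := by rw [zpow_add_one₀ hq0.ne']; ring

/-- **Distinct `γ^ℤ`-translates of a shell are disjoint** (everywhere, not only a.e.): if `γ^k • x` and `γ^j • x` both lie in `m⁻¹(A/q, A]` then `k = j`.
[cite: WeilBNT1967, Ch. II §5 Prop. 12] -/
theorem zpow_eq_of_mem_heightShell {m : α → ℝ} {γ : G} {q : ℝ} (hq : 1 < q) (hγ : ∀ x, m (γ • x) = q * m x) {A : ℝ} (hA : 0 < A)
    {x : α} {k j : ℤ} (hk : m (γ ^ k • x) ∈ Set.Ioc (A / q) A) (hj : m (γ ^ j • x) ∈ Set.Ioc (A / q) A) : k = j := by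
  have hq0 : 0 < q := lt_trans zero_lt_one hq
  rw [height_zpow_smul hq0.ne' hγ] at hk hj
  -- the height of `x` is positive since `q^k · m x > A/q > 0`
  have hx : 0 < m x := by
    have h := lt_trans (div_pos hA hq0) hk.1
    exact pos_of_mul_pos_right h (zpow_pos hq0 k).le
  exact zpow_eq_of_zpow_mul_mem_Ioc hq hx hk hj

/-- **«HEIGHT-SHELL FUNDAMENTAL DOMAINS».**  `m (γ • x) = q · m x` with `q > 1`, `m > 0` μ-almost everywhere, `A > 0`, and the shell `S_A = m⁻¹(A/q, A]` null-measurable: then `S_A` is a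
fundamental domain for the action of the cyclic subgroup `zpowers γ` — its translates `γ^k • S_A = m⁻¹(q^k A/q, q^k A]` tile `{m > 0}`. (For `0 < q < 1` apply this to `γ⁻¹`, `q⁻¹`:
`zpowers γ⁻¹ = zpowers γ`.) [cite: WeilBNT1967, Ch. II §5 Prop. 12] [cite: TateThesis1967, §2.3] -/
theorem isFundamentalDomain_heightShell [MeasurableSpace α] (μ : Measure α) {m : α → ℝ} {γ : G} {q : ℝ} (hq : 1 < q)
    (hγ : ∀ x, m (γ • x) = q * m x) (hpos : ∀ᵐ x ∂μ, 0 < m x) {A : ℝ} (hA : 0 < A)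
    (hS : NullMeasurableSet (m ⁻¹' Set.Ioc (A / q) A) μ) :
    IsFundamentalDomain (↥(Subgroup.zpowers γ)) (m ⁻¹' Set.Ioc (A / q) A) μ where
  nullMeasurableSet := hS
  ae_covers := by
    filter_upwards [hpos] with x hx
    obtain ⟨k, hk, -⟩ := existsUnique_zpow_mul_mem_Ioc hq hx hA
    refine ⟨⟨γ ^ k, k, rfl⟩, ?_⟩
    change m (γ ^ k • x) ∈ Set.Ioc (A / q) A
    rwa [height_zpow_smul (lt_trans zero_lt_one hq).ne' hγ]
  aedisjoint := by
    intro g g' hne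
    refine Disjoint.aedisjoint (Set.disjoint_left.2 fun x hx hx' => hne ?_)
    obtain ⟨_, k, rfl⟩ := g
    obtain ⟨_, j, rfl⟩ := g'
    rw [Set.mem_smul_set_iff_inv_smul_mem] at hx hx'
    change (γ ^ k)⁻¹ • x ∈ m ⁻¹' Set.Ioc (A / q) A at hx
    change (γ ^ j)⁻¹ • x ∈ m ⁻¹' Set.Ioc (A / q) A at hx'
    rw [← zpow_neg, Set.mem_preimage] at hx hx'
    have h := zpow_eq_of_mem_heightShell hq hγ hA hx hx'
    exact Subtype.ext (by rw [neg_inj.1 h])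

/-! ## §3 Shell independence of invariant masses and integrals -/

section Invariant

variable [MeasurableSpace α] (μ : Measure α) {m : α → ℝ} {γ : G} {q : ℝ}
  [MeasurableConstSMul ↥(Subgroup.zpowers γ) α] [SMulInvariantMeasure ↥(Subgroup.zpowers γ) α μ]

/-- **All shells have the same mass**: `μ(m⁻¹(A/q, A]) = μ(m⁻¹(A'/q, A'])` for a `G`-invariant `μ`. [cite: WeilBNT1967, Ch. II §5 Prop. 12] [cite: TateThesis1967, §2.4] -/
theorem measure_heightShell_eq (hq : 1 < q) (hγ : ∀ x, m (γ • x) = q * m x) (hpos : ∀ᵐ x ∂μ, 0 < m x)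
    {A A' : ℝ} (hA : 0 < A) (hA' : 0 < A') (hS : NullMeasurableSet (m ⁻¹' Set.Ioc (A / q) A) μ) (hS' : NullMeasurableSet (m ⁻¹' Set.Ioc (A' / q) A') μ) :
    μ (m ⁻¹' Set.Ioc (A / q) A) = μ (m ⁻¹' Set.Ioc (A' / q) A') :=
  (isFundamentalDomain_heightShell μ hq hγ hpos hA hS).measure_eq (isFundamentalDomain_heightShell μ hq hγ hpos hA' hS')

omit [MeasurableConstSMul ↥(Subgroup.zpowers γ) α] in
/-- **A shell has positive mass** as soon as `μ ≠ 0`. [cite: WeilBNT1967, Ch. II §5 Prop. 12] -/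
theorem measure_heightShell_ne_zero (hq : 1 < q) (hγ : ∀ x, m (γ • x) = q * m x) (hpos : ∀ᵐ x ∂μ, 0 < m x)
    {A : ℝ} (hA : 0 < A) (hS : NullMeasurableSet (m ⁻¹' Set.Ioc (A / q) A) μ) (hμ : μ ≠ 0) :
    μ (m ⁻¹' Set.Ioc (A / q) A) ≠ 0 :=
  (isFundamentalDomain_heightShell μ hq hγ hpos hA hS).measure_ne_zero hμ

/-- **The trace of a `γ`-invariant measurable set on a shell has shell-independent mass**: `μ(T ∩ S_A) = μ(T ∩ S_{A'})`. [cite: WeilBNT1967, Ch. II §5 Prop. 12] -/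
theorem measure_inter_heightShell_eq (hq : 1 < q) (hγ : ∀ x, m (γ • x) = q * m x) (hpos : ∀ᵐ x ∂μ, 0 < m x)
    {A A' : ℝ} (hA : 0 < A) (hA' : 0 < A') (hS : NullMeasurableSet (m ⁻¹' Set.Ioc (A / q) A) μ) (hS' : NullMeasurableSet (m ⁻¹' Set.Ioc (A' / q) A') μ)
    {T : Set α} (hTm : MeasurableSet T) (hT : (fun x => γ • x) ⁻¹' T = T) :
    μ (T ∩ m ⁻¹' Set.Ioc (A / q) A) = μ (T ∩ m ⁻¹' Set.Ioc (A' / q) A') :=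
  (isFundamentalDomain_heightShell μ hq hγ hpos hA hS).measure_set_eq (isFundamentalDomain_heightShell μ hq hγ hpos hA' hS') hTm
    (preimage_smul_eq_of_zpowers hT)

/-- **Shell independence of lower integrals of `γ`-invariant integrands.** [cite: TateThesis1967, §2.4] -/
theorem setLIntegral_heightShell_eq (hq : 1 < q) (hγ : ∀ x, m (γ • x) = q * m x) (hpos : ∀ᵐ x ∂μ, 0 < m x)
    {A A' : ℝ} (hA : 0 < A) (hA' : 0 < A') (hS : NullMeasurableSet (m ⁻¹' Set.Ioc (A / q) A) μ) (hS' : NullMeasurableSet (m ⁻¹' Set.Ioc (A' / q) A') μ)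
    (f : α → ENNReal) (hf : ∀ x, f (γ • x) = f x) :
    ∫⁻ x in m ⁻¹' Set.Ioc (A / q) A, f x ∂μ = ∫⁻ x in m ⁻¹' Set.Ioc (A' / q) A', f x ∂μ :=
  (isFundamentalDomain_heightShell μ hq hγ hpos hA hS).setLIntegral_eq (isFundamentalDomain_heightShell μ hq hγ hpos hA' hS') f
    (smul_invariant_zpowers hf)

/-- **Shell independence of Bochner integrals of `γ`-invariant integrands**: `∫_{S_A} f dμ = ∫_{S_{A'}} f dμ` — «`∫_{ϖ^k𝒪^×} f d^×x` does not depend on `k`».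
[cite: TateThesis1967, §2.4] [cite: WeilBNT1967, Ch. VII §2] -/
theorem setIntegral_heightShell_eq {E : Type*} [NormedAddCommGroup E] [NormedSpace ℝ E]
    (hq : 1 < q) (hγ : ∀ x, m (γ • x) = q * m x) (hpos : ∀ᵐ x ∂μ, 0 < m x)
    {A A' : ℝ} (hA : 0 < A) (hA' : 0 < A') (hS : NullMeasurableSet (m ⁻¹' Set.Ioc (A / q) A) μ) (hS' : NullMeasurableSet (m ⁻¹' Set.Ioc (A' / q) A') μ)
    (f : α → E) (hf : ∀ x, f (γ • x) = f x) :
    ∫ x in m ⁻¹' Set.Ioc (A / q) A, f x ∂μ = ∫ x in m ⁻¹' Set.Ioc (A' / q) A', f x ∂μ :=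
  (isFundamentalDomain_heightShell μ hq hγ hpos hA hS).setIntegral_eq (isFundamentalDomain_heightShell μ hq hγ hpos hA' hS')
    (smul_invariant_zpowers hf)

end Invariant

/-! ## §4 The vanishing engine: an eigen-symmetry with eigenvalue `≠ 1` -/

section Vanishing

variable [MeasurableSpace α] (μ : Measure α) {γ : G}
  [MeasurableConstSMul ↥(Subgroup.zpowers γ) α] [SMulInvariantMeasure ↥(Subgroup.zpowers γ) α μ]

omit [MeasurableConstSMul ↥(Subgroup.zpowers γ) α] [SMulInvariantMeasure ↥(Subgroup.zpowers γ) α μ] in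
/-- A translation `x ↦ g₀ • x` with measurable inverse is a measurable embedding. [cite: BourbakiINT7, Ch. VII §2 no. 10] -/
theorem measurableEmbedding_constSMul {g₀ : G} (h : Measurable (fun x : α => g₀ • x)) (hinv : Measurable (fun x : α => g₀⁻¹ • x)) :
    MeasurableEmbedding (fun x : α => g₀ • x) := by
  refine ⟨MulAction.injective g₀, h, fun t ht => ?_⟩
  rw [Set.image_smul, ← Set.preimage_smul_inv]
  exact hinv ht

omit [MeasurableConstSMul ↥(Subgroup.zpowers γ) α] [SMulInvariantMeasure ↥(Subgroup.zpowers γ) α μ] in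
/-- The inverse translation `x ↦ g₀⁻¹ • x` of a measure-preserving translation is measure preserving. [cite: BourbakiINT7, Ch. VII §2 no. 10] -/
theorem measurePreserving_inv_smul {g₀ : G} (hmp : MeasurePreserving (fun x : α => g₀ • x) μ μ) (hinv : Measurable (fun x : α => g₀⁻¹ • x)) :
    MeasurePreserving (fun x : α => g₀⁻¹ • x) μ μ :=
  let e : α ≃ᵐ α := { toEquiv := MulAction.toPerm g₀, measurable_toFun := hmp.measurable, measurable_invFun := hinv }
  (show MeasurePreserving e μ μ from hmp).symm e

omit [MeasurableConstSMul ↥(Subgroup.zpowers γ) α] [SMulInvariantMeasure ↥(Subgroup.zpowers γ) α μ] in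
/-- **A translate of a `zpowers γ`-fundamental domain by an element `g₀` commuting with `γ` and preserving `μ` is again a fundamental domain.**
[cite: WeilBNT1967, Ch. II §5 Prop. 12] -/
theorem isFundamentalDomain_smul_of_commute {s : Set α} (hs : IsFundamentalDomain (↥(Subgroup.zpowers γ)) s μ) {g₀ : G} (hg₀ : Commute g₀ γ)
    (hmp : MeasurePreserving (fun x : α => g₀ • x) μ μ) (hinv : Measurable (fun x : α => g₀⁻¹ • x)) :
    IsFundamentalDomain (↥(Subgroup.zpowers γ)) (g₀ • s) μ := by
  refine hs.image_of_equiv (MulAction.toPerm g₀)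
    (show Measure.QuasiMeasurePreserving (fun x : α => g₀⁻¹ • x) μ μ from (measurePreserving_inv_smul μ hmp hinv).quasiMeasurePreserving)
    (Equiv.refl _) fun g x => ?_
  obtain ⟨g, k, rfl⟩ := g
  change g₀ • (γ ^ k • x) = γ ^ k • (g₀ • x)
  rw [smul_smul, smul_smul, (hg₀.zpow_right k).eq]

omit [MeasurableConstSMul ↥(Subgroup.zpowers γ) α] [SMulInvariantMeasure ↥(Subgroup.zpowers γ) α μ] in
/-- **Change of variables along a measure-preserving translation**: `∫_{g₀ • s} f dμ = ∫_s f (g₀ • x) dμ` (`x ↦ g₀ • x` measure-preserving with measurable inverse).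
[cite: WeilBNT1967, Ch. II §5] -/
theorem setIntegral_smul_eq_setIntegral_comp_smul {E : Type*} [NormedAddCommGroup E] [NormedSpace ℝ E] {g₀ : G}
    (hmp : MeasurePreserving (fun x : α => g₀ • x) μ μ) (hinv : Measurable (fun x : α => g₀⁻¹ • x)) (f : α → E) (s : Set α) :
    ∫ x in g₀ • s, f x ∂μ = ∫ x in s, f (g₀ • x) ∂μ := by
  rw [← Set.image_smul]
  exact hmp.setIntegral_image_emb (measurableEmbedding_constSMul hmp.measurable hinv) f s

/-- **«A NON-TRIVIAL CHARACTER INTEGRATES TO ZERO OVER A PERIOD ANNULUS» — abstract form.**  `s` a fundamental domain for `zpowers γ` (acting measurably, `μ`-invariantly), `f`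
`γ`-invariant, `g₀` commuting with `γ` and preserving `μ` (measurable inverse) with `f (g₀ • x) = c • f x`, `c ≠ 1`.  Then `∫_s f dμ = 0`: indeed `∫_s f = ∫_{g₀ • s} f` (both fundamental domains,
`f` invariant) `= ∫_s f(g₀ • ·) = c • ∫_s f`.  With `α = E_w ∖ {0}`, `γ = ϖ_w^r`, `g₀ = ` a unit or a uniformiser and `f = χ` a multiplicative character this is at once
«`∫_{𝒪^×} χ = 0` for ramified `χ`» and «`r` consecutive shells cancel when `χ(ϖ)` is a non-trivial `r`-th root of unity» [TateThesis1967 §2.4] — no case distinction.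
[cite: TateThesis1967, §2.4] [cite: WeilBNT1967, Ch. VII §2] -/
theorem setIntegral_eq_zero_of_eigen_smul {𝕜 : Type*} [RCLike 𝕜] {E : Type*} [NormedAddCommGroup E] [NormedSpace ℝ E] [NormedSpace 𝕜 E]
    {s : Set α} (hs : IsFundamentalDomain (↥(Subgroup.zpowers γ)) s μ)
    (f : α → E) (hf : ∀ x, f (γ • x) = f x) {g₀ : G} (hg₀ : Commute g₀ γ)
    (hmp : MeasurePreserving (fun x : α => g₀ • x) μ μ) (hinv : Measurable (fun x : α => g₀⁻¹ • x))
    {c : 𝕜} (hc : c ≠ 1) (hfg₀ : ∀ x, f (g₀ • x) = c • f x) :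
    ∫ x in s, f x ∂μ = 0 := by
  have h1 : ∫ x in g₀ • s, f x ∂μ = ∫ x in s, f x ∂μ :=
    (isFundamentalDomain_smul_of_commute μ hs hg₀ hmp hinv).setIntegral_eq hs (smul_invariant_zpowers hf)
  have h2 : ∫ x in g₀ • s, f x ∂μ = c • ∫ x in s, f x ∂μ := by
    rw [setIntegral_smul_eq_setIntegral_comp_smul μ hmp hinv f s]
    simp_rw [hfg₀]
    exact integral_smul c _
  have h3 : (1 - c) • ∫ x in s, f x ∂μ = 0 := by rw [sub_smul, one_smul, ← h2, h1, sub_self]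
  exact (smul_eq_zero.1 h3).resolve_left (sub_ne_zero.2 (Ne.symm hc))

/-- **The same over a height shell** (§2 + the engine): `∫_{m⁻¹(A/q, A]} f dμ = 0`. [cite: TateThesis1967, §2.4] -/
theorem setIntegral_heightShell_eq_zero_of_eigen_smul {𝕜 : Type*} [RCLike 𝕜] {E : Type*} [NormedAddCommGroup E] [NormedSpace ℝ E] [NormedSpace 𝕜 E]
    {m : α → ℝ} {q : ℝ} (hq : 1 < q) (hγ : ∀ x, m (γ • x) = q * m x) (hpos : ∀ᵐ x ∂μ, 0 < m x)
    {A : ℝ} (hA : 0 < A) (hS : NullMeasurableSet (m ⁻¹' Set.Ioc (A / q) A) μ)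
    (f : α → E) (hf : ∀ x, f (γ • x) = f x) {g₀ : G} (hg₀ : Commute g₀ γ)
    (hmp : MeasurePreserving (fun x : α => g₀ • x) μ μ) (hinv : Measurable (fun x : α => g₀⁻¹ • x))
    {c : 𝕜} (hc : c ≠ 1) (hfg₀ : ∀ x, f (g₀ • x) = c • f x) :
    ∫ x in m ⁻¹' Set.Ioc (A / q) A, f x ∂μ = 0 :=
  setIntegral_eq_zero_of_eigen_smul μ (isFundamentalDomain_heightShell μ hq hγ hpos hA hS) f hf hg₀ hmp hinv hc hfg₀

end Vanishing

/-! ## §5 Building the two instances on `zpowers γ` from `γ` alone -/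

section Instances

variable [MeasurableSpace α] {γ : G}

/-- `γ^k • ·` is measurable for every `k ∈ ℤ` once `γ • ·` and `γ⁻¹ • ·` are. [cite: BourbakiINT7, Ch. VII §2 no. 10] -/
theorem measurable_zpow_smul (h : Measurable (fun x : α => γ • x)) (h' : Measurable (fun x : α => γ⁻¹ • x)) (k : ℤ) :
    Measurable (fun x : α => γ ^ k • x) := by
  induction k using Int.induction_on with
  | zero => simp only [zpow_zero, one_smul]; exact measurable_id'
  | succ n ih =>
    have : (fun x : α => γ ^ ((n : ℤ) + 1) • x) = (fun x => γ ^ (n : ℤ) • x) ∘ (fun x => γ • x) := by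
      funext x; rw [Function.comp_apply, zpow_add_one, mul_smul]
    rw [this]; exact ih.comp h
  | pred n ih =>
    have : (fun x : α => γ ^ (-(n : ℤ) - 1) • x) = (fun x => γ ^ (-(n : ℤ)) • x) ∘ (fun x => γ⁻¹ • x) := by
      funext x; rw [Function.comp_apply, zpow_sub_one, mul_smul]
    rw [this]; exact ih.comp h'

/-- **`zpowers γ` acts measurably as soon as `γ` and `γ⁻¹` do** (every element is `γ^k`). [cite: BourbakiINT7, Ch. VII §2 no. 10] -/
theorem measurableConstSMul_zpowers (h : Measurable (fun x : α => γ • x)) (h' : Measurable (fun x : α => γ⁻¹ • x)) :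
    MeasurableConstSMul (↥(Subgroup.zpowers γ)) α := by
  refine ⟨fun g => ?_⟩
  obtain ⟨g, k, rfl⟩ := g
  exact measurable_zpow_smul h h' k

/-- `γ^k • ·` is measure preserving for every `k ∈ ℤ` once `γ • ·` is (with measurable inverse). [cite: BourbakiINT7, Ch. VII §2 no. 10] -/
theorem measurePreserving_zpow_smul (μ : Measure α) (h : MeasurePreserving (fun x : α => γ • x) μ μ)
    (h' : Measurable (fun x : α => γ⁻¹ • x)) (k : ℤ) :
    MeasurePreserving (fun x : α => γ ^ k • x) μ μ := by
  have hinv : MeasurePreserving (fun x : α => γ⁻¹ • x) μ μ := measurePreserving_inv_smul μ h h'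
  induction k using Int.induction_on with
  | zero => simp only [zpow_zero, one_smul]; exact MeasurePreserving.id μ
  | succ n ih =>
    have : (fun x : α => γ ^ ((n : ℤ) + 1) • x) = (fun x => γ ^ (n : ℤ) • x) ∘ (fun x => γ • x) := by
      funext x; rw [Function.comp_apply, zpow_add_one, mul_smul]
    rw [this]; exact ih.comp h
  | pred n ih =>
    have : (fun x : α => γ ^ (-(n : ℤ) - 1) • x) = (fun x => γ ^ (-(n : ℤ)) • x) ∘ (fun x => γ⁻¹ • x) := by
      funext x; rw [Function.comp_apply, zpow_sub_one, mul_smul]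
    rw [this]; exact ih.comp hinv

/-- **A `γ`-preserved measure is `zpowers γ`-invariant.** [cite: BourbakiINT7, Ch. VII §2 no. 10] -/
theorem smulInvariantMeasure_zpowers (μ : Measure α) (h : MeasurePreserving (fun x : α => γ • x) μ μ)
    (h' : Measurable (fun x : α => γ⁻¹ • x)) :
    SMulInvariantMeasure (↥(Subgroup.zpowers γ)) α μ := by
  refine ⟨fun g s hs => ?_⟩
  obtain ⟨g, k, rfl⟩ := g
  change μ ((fun x : α => γ ^ k • x) ⁻¹' s) = μ s
  rw [← Measure.map_apply (measurePreserving_zpow_smul μ h h' k).measurable hs, (measurePreserving_zpow_smul μ h h' k).map_eq]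

end Instances

end Summit.HodgeConjecture.HodgeConjecture.Cruxes.H413.F0P3cStCharTSHeightShellFundamentalDomain

end
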